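import Literature.Probability.RandomPlanarGeometry.RestrictionMeasuresOneBubbleLeaf
import Literature.Probability.RandomPlanarGeometry.BrownianLoopBubble
import HarnessLib

/-!
# [LSW] p. 5 result 1: the restriction measure `P_α` exists iff `α ≥ 5/8` — discharge of `exists_isRestrictionMeasure_iff`

Proof-only file (no definition, no named fact), after

* G. F. Lawler, O. Schramm, W. Werner, *Conformal restriction: the chordal case*, J. Amer.
  Math. Soc. **16** (2003) 917–955, arXiv:math/0209343 (**[LSW]**), p. 5, first displayed
  result: "The (two-sided) restriction measure `P_α` exists if and only if `α ≥ 5/8`", proved in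
  the paper by Thm. 7.3 (p. 29: for `κ ∈ (0, 8/3]` the filling of SLE_κ with a Poisson cloud of
  Brownian bubbles of intensity `λ_κ` has law `P_α`, `α = (6 − κ)/(2κ)` ranging over `[5/8, ∞)`;
  `κ = 8/3`, `λ = 0`: Thm. 6.1) and Cor. 8.6 (pp. 37–38: no `P_α` for `α < 5/8`).

The tree reduced the named fact `exists_isRestrictionMeasure_iff` (file `RestrictionMeasures`)
to the existence of the Brownian bubble measure of §7.1
(`exists_isRestrictionMeasure_iff_of_bubble_measure`, file `RestrictionMeasuresOneBubbleLeaf`: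
the only-if half, Cor. 8.6, and the SLE_κ-with-bubbles half, Thm. 6.5/7.3, being proved there and
upstream), and the Brownian bubble measure now exists (`exists_isBrownianBubbleMeasure_holds`,
file `BrownianLoopBubble`: the filling of the planar image of the Brownian loop at `0` in `ℝ⁴`,
with the hitting masses (7.2)). Hence:

* `exists_isRestrictionMeasure_iff_holds` — **DISCHARGE of [LSW] p. 5 result 1**;
* `exists_isRestrictionMeasure_of_five_eighths_le` … recorded consequences: `P_α` exists for
  every `α ≥ 5/8` ([LSW] Thm. 7.3 and the sentence following it, "for all `α > 5/8` the
  restriction measure `P_α` exists").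

## References

* [LSW] p. 5 result 1; Thm. 7.3 (p. 29); Cor. 8.6 (pp. 37–38); §7.1 (pp. 27–28). [LawlerSchrammWerner2003Restriction]
-/

noncomputable section

namespace Literature.Probability.RandomPlanarGeometry

/-- **DISCHARGE of `exists_isRestrictionMeasure_iff` — [LSW] p. 5 result 1: for `α > 0`, the
two-sided restriction measure `P_α` exists iff `α ≥ 5/8`.** Assembled from the tree's reduction
to the Brownian bubble measure (`exists_isRestrictionMeasure_iff_of_bubble_measure`: Cor. 8.6 for
the only-if half; Thm. 6.5 for SLE_κ, `κ ≤ 8/3`, and Thm. 7.3, SLE_κ plus a Poisson cloud of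
Brownian bubbles, for the if half) and the existence of the Brownian bubble measure
(`exists_isBrownianBubbleMeasure_holds`, §7.1).
[cite: LawlerSchrammWerner2003Restriction, p. 5 result 1 (with Thm. 7.3 p. 29 and Cor. 8.6 pp. 37–38)] -/
theorem exists_isRestrictionMeasure_iff_holds : exists_isRestrictionMeasure_iff :=
  exists_isRestrictionMeasure_iff_of_bubble_measure exists_isBrownianBubbleMeasure_holds

/-- **`P_α` exists for every `α ≥ 5/8`** ([LSW] Thm. 7.3 and the sentence after its proof: "We
have now proved that for all `α > 5/8` the restriction measure `P_α` exists"; `α = 5/8` is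
Thm. 6.1). [cite: LawlerSchrammWerner2003Restriction, Thm. 7.3 (p. 29)] -/
theorem exists_isRestrictionMeasure_of_five_eighths_le {α : ℝ} (hα : 5 / 8 ≤ α) :
    ∃ P : MeasureTheory.Measure RestrictionConfig, IsRestrictionMeasure α P :=
  exists_isRestrictionMeasure_of_five_eighths_le_of_bubble_measure exists_isBrownianBubbleMeasure_holds hα

/-- **`P_α` exists for `α > 0` iff `α ≥ 5/8`**, unfolded form of the discharged fact. [cite: LawlerSchrammWerner2003Restriction, p. 5 result 1] -/
theorem exists_isRestrictionMeasure_iff_five_eighths_le {α : ℝ} (hα : 0 < α) :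
    (∃ P : MeasureTheory.Measure RestrictionConfig, IsRestrictionMeasure α P) ↔ 5 / 8 ≤ α :=
  exists_isRestrictionMeasure_iff_holds α hα

end Literature.Probability.RandomPlanarGeometry

end
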